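/-
Copyright (c) 2026 the pub-hodgecm-mathlib formalisation cell (harness21).  Prover seat hodgecm-mathlib-LH4-p08 (g11) (valve hand), Track B «K2-LIT»,
#184♮ = hLiu418 = `stmt-HodgeConjecture-24832`; socket #41, KIND W — LEAD F0P6-plan (g14) BATCH #167 (2) 2026-09-04T23:48:34Z «the ONE per-place
archimedean Whittaker letter `hW` that ★ `K2LiuKindWArchContinuation` (LH4-p10 (g8)) takes BY VALUE»; handshake LH4-p10 23:50:20Z (`eb` abstract + reading,
JUNCTION's `∃ Ew s₀` shape); KW desk F0P2-p08 (g3).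
THEOREMS ONLY (no `def`, no `instance`, no notation, no named-fact hypothesis, no `sorry`).
-/
import Summits.HodgeConjecture.HodgeConjecture.Theorems.K2LiuArchBlockOfFrame                         -- ★ FILE 10: antidiagonal Levi algebra, chart, ★ LeviEquivariance, `Carrier`
import Summits.HodgeConjecture.HodgeConjecture.Theorems.K2LiuKFiniteSectionWhittakerHolomorphyGrowth   -- ★ JUNCTION `kFiniteSection_whittaker_holomorphy_growth`
import Summits.HodgeConjecture.HodgeConjecture.Theorems.K2LiuHermitianTubeAction                      -- ★ `exists_transl_levi_mul_stabilizer` (arch Iwasawa `U(J) = P·Stab(iI)`)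
import Summits.HodgeConjecture.HodgeConjecture.Theorems.K2LiuHermTwoEtaDefs                           -- ★ `hermTwo_add`
import HarnessLib

/-!
# Crux `HLiu418`, socket #41, KIND W — `K2LiuKindWArchWhittakerLetter`: THE PER-PLACE ARCHIMEDEAN WHITTAKER LETTER `hW` AT A DEFINITE FRAMED INDEX

Cell `hodgecm-mathlib`, crux item hLiu418 = `stmt-HodgeConjecture-24832` (helper lane `--supports … --as helper`, count-neutral), route of record `HCCMUnconditional`;
squad K2 ∕ K2Liu, road `K2_Liu`, socket #41 `sig_K2LiuSiegelEisensteinContinuation`, KIND W.  ★ `K2LiuKindWArchContinuation` (LH4-p10 (g8)) closes the archimedean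
existence letter `hex` of ★ `K2LiuKindWArchLetterDefs` from the record frame letters and ONE per-place twisted letter BY VALUE,
  `hW w : ∃ Ew s₀, DifferentiableOn ℂ Ew {0 < re} ∧ ∀ s, s₀ < re s → ∀ F ∈ I_w(s, χ_{k_w}) with compact picture Q_w,`
  `        ∫_{Herm₂} F(x_w · n(b) · g_w) · e_w(b) db = Ew s`  (`x_w = (0 B_w; C_w 0)` the frame image of `w_Δ`, `g_w = Fr h w`, `e_w` the frame reading of `conj ψ_S`).
THIS FILE PAYS `hW w` AT A POSITIVE DEFINITE FRAMED INDEX (`e_w(b) = e(−tr(hidx·b))`, `hidx ≻ 0`) from ★ material, modulo ONE algebraic bridge carried BY VALUE: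
* **`exists_twistedWhittaker_continuation_of_posDef`** — hypotheses: weight `k ≥ −2` (★ JUNCTION's holomorphy window `{0 < re(s + 1 + k∕2)} ⊇ {0 < re s}`),
  picture `Q : Carrier`, `x = (0 B; C 0) ∈ U(J)`, `g ∈ U(J)`, `hidx.PosDef`, the twist `eb` with its reading `heb`, and `hKpic`: «for every `k₀ ∈ Stab(iI)` the
  K-picture of the right translate `F(· k₀)` of any section `F ∈ I_w(s, χ_k)` with Carrier picture `Q` is ONE polynomial in `(u, ū)` on `Stab(iI)`» (= ★ JUNCTION's
  K-finiteness hypothesis for the translate; payer: `K2LiuKindWArchWhittakerKPicture`); conclusion = the `hW w` bytes in the `∃ Ew s₀` shape (handshake LH4-p10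
  2026-09-04T23:50:20Z).
THE ROAD (all ★): frame algebra `x·n(X)·g = J·n(C X Cᴴ)·(m₀ g)`, `m₀ = diag(C, −B)` (★ FILE 10 `antidiag_eq_J_mul_levi`, `levi_mul_transl`); chart ★
`integral_hermOfReal_eq` (`∫ G(hermOfReal r) dr = ⅛ ∫ G(hermTwo c) dc`); substitution ★ `integral_comp_hermTwo_conj` (index `h₁ = C⁻ᴴ·hidx·C⁻¹ ≻ 0`, ★ `trace_mul_conj`);
arch Iwasawa ★ `exists_transl_levi_mul_stabilizer` (`m₀ g = n(X₀)·m(R,R⁻¹)·u₀`, `X₀, R` hermitian, `R` invertible, `u₀ ∈ Stab(iI)`); translation `X ↦ X − X₀` on the chart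
(★ `hermTwo_eq_of_isHermitian`, `hermTwo_add`, Mathlib `integral_add_left_eq_self`; phase `e(tr h₁X₀)`); right translation by `u₀` (★ `isArchSiegelSection_rightTranslate`,
K-picture by `hKpic`); ★ `whittaker_levi_equivariance` (index `h₂ = Rᴴh₁R ≻ 0`, factor `χ_k(det R⁻¹)·‖det R‖^{2−2s}`); ★ JUNCTION
`kFiniteSection_whittaker_holomorphy_growth` (iii) at `h₂` and (i) on `{0 < re s}`.  Value:
`Ew s = ⅛ · ‖det C‖⁻⁴ · e(tr h₁X₀) · χ_k(det R⁻¹) · ‖det R‖^{2−2s} · F_J(h₂, s)`, `s₀ =` JUNCTION's.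
What is NOT here (honest): the INDEFINITE framed index (signature (1,1)) — the organ «Φ6b-ind» (Shimura 1982 §3–§4), OPEN; the bridge `hKpic` (next file).
[Shimura1997, §16.4, §18.4] [KudlaRallis1994, §1] [MoeglinWaldspurger1995, II.1.7]; Shimura 1982 (Math. Ann. 260), (1.31), §3 (prose reference; no registered key).
HONEST LABEL.  Count-neutral helper, closes no socket: `HC_CM` is proved only modulo the 7 printed citations (2 remaining named inputs: hLiu418 =
`stmt-HodgeConjecture-24832`, h413 = `stmt-HodgeConjecture-24833`) until rung 0 closes.
-/

set_option autoImplicit false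
set_option linter.dupNamespace false -- the mandated namespace repeats `HodgeConjecture.HodgeConjecture`

noncomputable section

open Complex Matrix MeasureTheory
open scoped ComplexConjugate ComplexOrder
open Literature.NumberTheory.ModularForms.SiegelUpperHalfSpace (moeb)

namespace Summit.HodgeConjecture.HodgeConjecture.Cruxes.HLiu418.K2LiuKindWArchWhittakerLetter

open Summit.HodgeConjecture.HodgeConjecture.Cruxes.HLiu418.K2LiuHermTwoGammaDefs (hermTwo hermTwo_eq_of_isHermitian)
open Summit.HodgeConjecture.HodgeConjecture.Cruxes.HLiu418.K2LiuHermTwoEtaDefs (hermTwo_add)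
open Summit.HodgeConjecture.HodgeConjecture.Cruxes.HLiu418.K2LiuHermitianTubeCocycle (mul_mem_UJ J_mem)
open Summit.HodgeConjecture.HodgeConjecture.Cruxes.HLiu418.K2LiuHermitianTubeAction (exists_transl_levi_mul_stabilizer)
open Summit.HodgeConjecture.HodgeConjecture.Cruxes.HLiu418.K2LiuArchInducedTubeDefs
open Summit.HodgeConjecture.HodgeConjecture.Cruxes.HLiu418.K2LiuU22CompactPictureDefs
open Summit.HodgeConjecture.HodgeConjecture.Cruxes.HLiu418.K2LiuArchWhittakerLeviEquivariance
open Summit.HodgeConjecture.HodgeConjecture.Cruxes.HLiu418.K2LiuArchIntertwiningScalarValue (integral_hermOfReal_eq)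
open Summit.HodgeConjecture.HodgeConjecture.Cruxes.HLiu418.K2LiuArchBlockOfFrame (antidiag_letters antidiag_eq_J_mul_levi levi_mul_transl)
open Summit.HodgeConjecture.HodgeConjecture.Cruxes.HLiu418.K2LiuKFiniteSectionWhittakerHolomorphyGrowth (kFiniteSection_whittaker_holomorphy_growth)

/-- **THE PER-PLACE ARCHIMEDEAN WHITTAKER LETTER AT A DEFINITE FRAMED INDEX** (★ `K2LiuKindWArchContinuation`'s by-value `hW w`, in the handshake's
`∃ Ew s₀` shape).  Data at one complex place: a weight `k ≥ −2`, a compact picture `Q`, the frame image `x = (0 B; C 0) ∈ U(J)` of `w_Δ`, a point `g ∈ U(J)`, a POSITIVE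
DEFINITE framed index `hidx`, and the twist `eb` with its reading `eb b = e(−tr(hidx·b))` BY VALUE; plus ONE algebraic bridge BY VALUE, `hKpic` («the K-picture of a
`Stab(iI)`-translate of a section with Carrier picture `Q` is a polynomial in `(u, ū)`» — payer: `K2LiuKindWArchWhittakerKPicture`).  CONCLUSION: `∃ Ew s₀`, `Ew` holomorphic on
`{0 < re s}`, such that for `s₀ < re s` and EVERY section `F ∈ I_w(s, χ_k)` with compact picture `Q`,
`∫_{Herm₂} F(x · n(b) · g) · eb(b) db = Ew s` (chart `hermOfReal`).
Road: `x·n(X)·g = J·n(CXCᴴ)·(m₀ g)` (★ FILE 10), chart ★ `integral_hermOfReal_eq`, substitution ★ `integral_comp_hermTwo_conj` (index `h₁ = C⁻ᴴ·hidx·C⁻¹`),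
arch Iwasawa ★ `exists_transl_levi_mul_stabilizer` of `m₀ g = n(X₀)·m(R,R⁻¹)·u₀`, translation `X ↦ X − X₀` (phase `e(tr h₁X₀)`), right translate by `u₀`
(★ `isArchSiegelSection_rightTranslate`, K-picture by `hKpic`), ★ `whittaker_levi_equivariance` (index `h₂ = Rᴴh₁R ≻ 0`, factor `χ_k(det R⁻¹)‖det R‖^{2−2s}`), and
★ JUNCTION `kFiniteSection_whittaker_holomorphy_growth` (iii) at `h₂`, (i) on `{0 < re} ⊆ {0 < re(s+1+k∕2)}`.
[cite: Shimura1997, §16.4, §18.4] [cite: KudlaRallis1994, §1] -/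
theorem exists_twistedWhittaker_continuation_of_posDef {k : ℤ} (hk : -2 ≤ k) (Q : Carrier)
    {B C : Matrix (Fin 2) (Fin 2) ℂ}
    (hx : (fromBlocks 0 B C 0 : Matrix (Fin 2 ⊕ Fin 2) (Fin 2 ⊕ Fin 2) ℂ)ᴴ * Matrix.J (Fin 2) ℂ * (fromBlocks 0 B C 0 : Matrix (Fin 2 ⊕ Fin 2) (Fin 2 ⊕ Fin 2) ℂ) =
      Matrix.J (Fin 2) ℂ)
    {g : Matrix (Fin 2 ⊕ Fin 2) (Fin 2 ⊕ Fin 2) ℂ} (hg : gᴴ * Matrix.J (Fin 2) ℂ * g = Matrix.J (Fin 2) ℂ)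
    {hidx : Matrix (Fin 2) (Fin 2) ℂ} (hpos : hidx.PosDef)
    {eb : Matrix (Fin 2) (Fin 2) ℂ → ℂ} (heb : ∀ b, eb b = cexp (-(2 * Real.pi * I) * (hidx * b).trace))
    (hKpic : ∀ k₀ : Matrix (Fin 2 ⊕ Fin 2) (Fin 2 ⊕ Fin 2) ℂ, k₀ᴴ * Matrix.J (Fin 2) ℂ * k₀ = Matrix.J (Fin 2) ℂ →
      moeb k₀ (I • (1 : Matrix (Fin 2) (Fin 2) ℂ)) = I • 1 →
      ∃ P : MvPolynomial (((Fin 2 ⊕ Fin 2) × (Fin 2 ⊕ Fin 2)) ⊕ ((Fin 2 ⊕ Fin 2) × (Fin 2 ⊕ Fin 2))) ℂ,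
        ∀ (s : ℂ) (F : Matrix (Fin 2 ⊕ Fin 2) (Fin 2 ⊕ Fin 2) ℂ → ℂ), IsArchSiegelSection (fun z : ℂ => (conj z / ((‖z‖ : ℝ) : ℂ)) ^ k) s F →
          (∀ (v : Matrix (Fin 2) (Fin 2) ℂ), vᴴ * v = 1 → ∀ hv : v.det ≠ 0,
            F ((2 : ℂ)⁻¹ • fromBlocks (1 + v) (-(I • (1 - v))) (I • (1 - v)) (1 + v) : Matrix (Fin 2 ⊕ Fin 2) (Fin 2 ⊕ Fin 2) ℂ) = evalAt v hv Q) →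
          ∀ u : Matrix (Fin 2 ⊕ Fin 2) (Fin 2 ⊕ Fin 2) ℂ, uᴴ * Matrix.J (Fin 2) ℂ * u = Matrix.J (Fin 2) ℂ → moeb u (I • (1 : Matrix (Fin 2) (Fin 2) ℂ)) = I • 1 →
            F (u * k₀) = MvPolynomial.eval (Sum.elim (fun pq => u pq.1 pq.2) (fun pq => conj (u pq.1 pq.2))) P) :
    ∃ (Ew : ℂ → ℂ) (s₀ : ℝ), DifferentiableOn ℂ Ew {s : ℂ | 0 < s.re} ∧ ∀ s : ℂ, s₀ < s.re →
      ∀ F : Matrix (Fin 2 ⊕ Fin 2) (Fin 2 ⊕ Fin 2) ℂ → ℂ, IsArchSiegelSection (fun z : ℂ => (conj z / ((‖z‖ : ℝ) : ℂ)) ^ k) s F →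
        (∀ (v : Matrix (Fin 2) (Fin 2) ℂ), vᴴ * v = 1 → ∀ hv : v.det ≠ 0,
          F ((2 : ℂ)⁻¹ • fromBlocks (1 + v) (-(I • (1 - v))) (I • (1 - v)) (1 + v) : Matrix (Fin 2 ⊕ Fin 2) (Fin 2 ⊕ Fin 2) ℂ) = evalAt v hv Q) →
        ∫ r : Fin 2 → Fin 2 → ℝ, F ((fromBlocks 0 B C 0 : Matrix (Fin 2 ⊕ Fin 2) (Fin 2 ⊕ Fin 2) ℂ) * fromBlocks 1 (hermOfReal r) 0 1 * g) * eb (hermOfReal r) =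
          Ew s := by
  /- §0 frame letters -/
  obtain ⟨hCB, hBC⟩ := antidiag_letters hx
  have hC : C.det ≠ 0 := (Matrix.isUnit_det_of_left_inverse hBC).ne_zero
  have hCu : IsUnit C.det := isUnit_iff_ne_zero.2 hC
  have hCiC : C⁻¹ * C = 1 := Matrix.nonsing_inv_mul C hCu
  have hCCi : C * C⁻¹ = 1 := Matrix.mul_nonsing_inv C hCu
  have hm₀ := levi_mem hBC                                   -- `m₀ := diag(C, −B) ∈ U(J)`
  have hg' := mul_mem_UJ hm₀ hg                              -- `g' := m₀ · g ∈ U(J)`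
  /- §1 arch Iwasawa of `g'` and the K-picture of the `u₀`-translates -/
  obtain ⟨X₀, R, u₀, hX₀, hR, hRu, hu₀J, hu₀i, hg'eq⟩ := exists_transl_levi_mul_stabilizer hg'
  obtain ⟨P, hP⟩ := hKpic u₀ hu₀J hu₀i
  have hRRi : R * R⁻¹ = 1 := Matrix.mul_nonsing_inv R hRu
  have hRiR : R⁻¹ * R = 1 := Matrix.nonsing_inv_mul R hRu
  have had : Rᴴ * R⁻¹ = 1 := by rw [hR, hRRi]
  have hRdet : R.det ≠ 0 := hRu.ne_zero
  /- §2 the two index changes and the JUNCTION at the final index -/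
  set h₁ : Matrix (Fin 2) (Fin 2) ℂ := (C⁻¹)ᴴ * hidx * C⁻¹ with hh₁
  set h₂ : Matrix (Fin 2) (Fin 2) ℂ := Rᴴ * h₁ * R with hh₂
  have hCiu : IsUnit C⁻¹ := by
    rw [Matrix.isUnit_iff_isUnit_det]; exact Matrix.isUnit_det_of_left_inverse hCCi
  have hRu' : IsUnit R := (Matrix.isUnit_iff_isUnit_det R).2 hRu
  have h₁pos : h₁.PosDef := hpos.conjTranspose_mul_mul_same (Matrix.mulVec_injective_iff_isUnit.2 hCiu)
  have h₂pos : h₂.PosDef := h₁pos.conjTranspose_mul_mul_same (Matrix.mulVec_injective_iff_isUnit.2 hRu')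
  obtain ⟨FJ, s₀, hFJhol, -, hFJint⟩ := kFiniteSection_whittaker_holomorphy_growth P k
  -- the holomorphy window `{0 < re} ⊆ {0 < re(s + 1 + k∕2)}`
  have hwin : ∀ s ∈ {s : ℂ | 0 < s.re}, 0 < (s + 1 + (k : ℂ) / 2).re := by
    intro s hs
    have hk' : (-2 : ℝ) ≤ (k : ℝ) := by exact_mod_cast hk
    have hre : (s + 1 + (k : ℂ) / 2).re = s.re + 1 + (k : ℝ) / 2 := by
      simp [Complex.add_re, Complex.div_ofNat_re]
    rw [hre]
    have : (0 : ℝ) < s.re := hs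
    linarith
  have hopen : IsOpen {s : ℂ | 0 < s.re} := isOpen_lt continuous_const Complex.continuous_re
  /- §3 the constants -/
  set χ : ℂ → ℂ := fun z : ℂ => (conj z / ((‖z‖ : ℝ) : ℂ)) ^ k with hχ
  set K₀ : ℂ := cexp ((2 * Real.pi * I) * (h₁ * X₀).trace) with hK₀
  have hRpos : 0 < ‖R.det‖ := norm_pos_iff.2 hRdet
  refine ⟨fun s => (1 / 8 : ℂ) * (((((‖C.det‖ : ℝ) : ℂ) ^ 4)⁻¹) * (K₀ * (χ R⁻¹.det * (((‖R.det‖ : ℝ) : ℂ) ^ (2 - 2 * s) * FJ h₂ s)))),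
    s₀, ?_, fun s hs F hF hFQ => ?_⟩
  · -- holomorphy on `{0 < re}`
    have hpow : Differentiable ℂ (fun s : ℂ => ((‖R.det‖ : ℝ) : ℂ) ^ (2 - 2 * s)) :=
      Differentiable.const_cpow ((differentiable_const _).sub ((differentiable_const _).mul differentiable_id))
        (Or.inl (ofReal_ne_zero.2 hRpos.ne'))
    exact (differentiableOn_const _).mul ((differentiableOn_const _).mul ((differentiableOn_const _).mul
      ((differentiableOn_const _).mul (hpow.differentiableOn.mul (hFJhol hopen hwin h₂pos)))))
  · /- §4 the identity at `s₀ < re s` -/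
    -- the right translate by `u₀` is a section with polynomial K-picture `P`
    set f : Matrix (Fin 2 ⊕ Fin 2) (Fin 2 ⊕ Fin 2) ℂ → ℂ := fun y => F (y * u₀) with hf
    have hfS : IsArchSiegelSection χ s f := isArchSiegelSection_rightTranslate hF u₀
    have hfK : ∀ u : Matrix (Fin 2 ⊕ Fin 2) (Fin 2 ⊕ Fin 2) ℂ, uᴴ * Matrix.J (Fin 2) ℂ * u = Matrix.J (Fin 2) ℂ →
        moeb u (I • (1 : Matrix (Fin 2) (Fin 2) ℂ)) = I • 1 →
        f u = MvPolynomial.eval (Sum.elim (fun pq => u pq.1 pq.2) (fun pq => conj (u pq.1 pq.2))) P :=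
      fun u hu hui => hP s F hF hFQ u hu hui
    -- the twist read at `h₁`: `eb X = e₁ (C X Cᴴ)`
    have heb₁ : ∀ X : Matrix (Fin 2) (Fin 2) ℂ, eb X = cexp (-(2 * Real.pi * I) * (h₁ * (C * X * Cᴴ)).trace) := by
      intro X
      rw [heb, trace_mul_conj h₁ C X, hh₁]
      congr 3
      rw [show Cᴴ * ((C⁻¹)ᴴ * hidx * C⁻¹) * C = (C⁻¹ * C)ᴴ * hidx * (C⁻¹ * C) by
        rw [Matrix.conjTranspose_mul]; simp only [Matrix.mul_assoc], hCiC, Matrix.conjTranspose_one, Matrix.one_mul, Matrix.mul_one]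
    -- the frame algebra: `x · n(X) · g = J · n(C X Cᴴ) · g'`
    have e1 : ∀ X : Matrix (Fin 2) (Fin 2) ℂ, (fromBlocks 0 B C 0 : Matrix (Fin 2 ⊕ Fin 2) (Fin 2 ⊕ Fin 2) ℂ) * fromBlocks 1 X 0 1 * g =
        Matrix.J (Fin 2) ℂ * fromBlocks 1 (C * X * Cᴴ) 0 1 * (fromBlocks C 0 0 (-B) * g) := by
      intro X
      rw [antidiag_eq_J_mul_levi, Matrix.mul_assoc (Matrix.J (Fin 2) ℂ), levi_mul_transl hCB, ← Matrix.mul_assoc (Matrix.J (Fin 2) ℂ),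
        Matrix.mul_assoc _ _ g]
    -- the Iwasawa rewriting: `J · n(Y) · g' = (J · n(Y + X₀) · m(R,R⁻¹)) · u₀`
    have e2 : ∀ Y : Matrix (Fin 2) (Fin 2) ℂ, Matrix.J (Fin 2) ℂ * fromBlocks 1 Y 0 1 * (fromBlocks C 0 0 (-B) * g) =
        Matrix.J (Fin 2) ℂ * fromBlocks 1 (Y + X₀) 0 1 * fromBlocks R 0 0 R⁻¹ * u₀ := by
      intro Y
      have hn : (fromBlocks 1 Y 0 1 : Matrix (Fin 2 ⊕ Fin 2) (Fin 2 ⊕ Fin 2) ℂ) * fromBlocks 1 X₀ 0 1 = fromBlocks 1 (Y + X₀) 0 1 := by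
        rw [fromBlocks_multiply]; simp [add_comm]
      rw [hg'eq, ← hn]
      simp only [Matrix.mul_assoc]
    -- the twisted integrand in the two charts
    set G : Matrix (Fin 2) (Fin 2) ℂ → ℂ := fun Y =>
      F (Matrix.J (Fin 2) ℂ * fromBlocks 1 Y 0 1 * (fromBlocks C 0 0 (-B) * g)) * cexp (-(2 * Real.pi * I) * (h₁ * Y).trace) with hG
    set c₀ : ℝ × ℂ × ℝ := ((X₀ 0 0).re, X₀ 0 1, (X₀ 1 1).re) with hc₀
    have hX₀c : hermTwo c₀ = X₀ := hermTwo_eq_of_isHermitian hX₀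
    set G₂ : ℝ × ℂ × ℝ → ℂ := fun c =>
      f (Matrix.J (Fin 2) ℂ * fromBlocks 1 (hermTwo c) 0 1 * fromBlocks R 0 0 R⁻¹) * cexp (-(2 * Real.pi * I) * (h₁ * hermTwo c).trace) * K₀ with hG₂
    -- Step A+B: chart and frame algebra, pointwise
    have hAB : ∀ X : Matrix (Fin 2) (Fin 2) ℂ,
        F ((fromBlocks 0 B C 0 : Matrix (Fin 2 ⊕ Fin 2) (Fin 2 ⊕ Fin 2) ℂ) * fromBlocks 1 X 0 1 * g) * eb X = G (C * X * Cᴴ) := by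
      intro X; rw [hG, e1, heb₁]
    -- Step D pointwise: `G (hermTwo c) = G₂ (c₀ + c)`
    have hD : ∀ c : ℝ × ℂ × ℝ, G (hermTwo c) = G₂ (c₀ + c) := by
      intro c
      have hY : hermTwo (c₀ + c) = hermTwo c + X₀ := by rw [hermTwo_add, hX₀c, add_comm]
      simp only [hG, hG₂, hf]
      rw [e2, hY, mul_assoc (F _)]
      congr 1
      rw [hK₀, ← Complex.exp_add]
      congr 1
      rw [Matrix.mul_add, Matrix.trace_add]
      ring
    -- Lebesgue measure on the chart `ℝ × ℂ × ℝ` is an additive Haar measure (as in ★ `integral_hermOfReal_eq`)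
    haveI hCvol : ((volume : Measure ℂ).prod (volume : Measure ℝ)).IsAddHaarMeasure := Measure.prod.instIsAddHaarMeasure _ _
    haveI : (volume : Measure (ℝ × ℂ × ℝ)).IsAddHaarMeasure := by
      rw [show (volume : Measure (ℝ × ℂ × ℝ)) = (volume : Measure ℝ).prod ((volume : Measure ℂ).prod (volume : Measure ℝ)) from rfl]
      exact Measure.prod.instIsAddHaarMeasure _ _
    calc ∫ r : Fin 2 → Fin 2 → ℝ, F ((fromBlocks 0 B C 0 : Matrix (Fin 2 ⊕ Fin 2) (Fin 2 ⊕ Fin 2) ℂ) * fromBlocks 1 (hermOfReal r) 0 1 * g) * eb (hermOfReal r)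
        = (1 / 8 : ℂ) * ∫ c : ℝ × ℂ × ℝ, G (C * hermTwo c * Cᴴ) := by
          rw [integral_hermOfReal_eq (fun X => F ((fromBlocks 0 B C 0 : Matrix (Fin 2 ⊕ Fin 2) (Fin 2 ⊕ Fin 2) ℂ) * fromBlocks 1 X 0 1 * g) * eb X)]
          simp only [hAB]
      _ = (1 / 8 : ℂ) * ((((‖C.det‖ : ℝ) : ℂ) ^ 4)⁻¹ * ∫ c : ℝ × ℂ × ℝ, G (hermTwo c)) := by
          congr 1
          rw [integral_comp_hermTwo_conj hC G, Complex.real_smul, ofReal_pow, ← mul_assoc,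
            inv_mul_cancel₀ (pow_ne_zero _ (ofReal_ne_zero.2 (norm_pos_iff.2 hC).ne')), one_mul]
      _ = (1 / 8 : ℂ) * ((((‖C.det‖ : ℝ) : ℂ) ^ 4)⁻¹ * ∫ c : ℝ × ℂ × ℝ, G₂ c) := by
          simp only [hD]
          rw [integral_add_left_eq_self G₂ c₀]
      _ = (1 / 8 : ℂ) * ((((‖C.det‖ : ℝ) : ℂ) ^ 4)⁻¹ * (K₀ *
            ∫ c : ℝ × ℂ × ℝ, f (Matrix.J (Fin 2) ℂ * fromBlocks 1 (hermTwo c) 0 1 * fromBlocks R 0 0 R⁻¹) *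
              cexp (-(2 * Real.pi * I) * (h₁ * hermTwo c).trace))) := by
          rw [hG₂, integral_mul_const, mul_comm _ K₀]
      _ = (1 / 8 : ℂ) * ((((‖C.det‖ : ℝ) : ℂ) ^ 4)⁻¹ * (K₀ * (χ R⁻¹.det * (((‖R.det‖ : ℝ) : ℂ) ^ (2 - 2 * s) *
            ∫ c : ℝ × ℂ × ℝ, f (Matrix.J (Fin 2) ℂ * fromBlocks 1 (hermTwo c) 0 1) * cexp (-(2 * Real.pi * I) * (h₂ * hermTwo c).trace))))) := by
          rw [whittaker_levi_equivariance hfS had h₁, hh₂, mul_assoc (χ R⁻¹.det)]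
      _ = (1 / 8 : ℂ) * ((((‖C.det‖ : ℝ) : ℂ) ^ 4)⁻¹ * (K₀ * (χ R⁻¹.det * (((‖R.det‖ : ℝ) : ℂ) ^ (2 - 2 * s) * FJ h₂ s)))) := by
          rw [hFJint h₂ h₂pos s hs f hfS hfK]

end Summit.HodgeConjecture.HodgeConjecture.Cruxes.HLiu418.K2LiuKindWArchWhittakerLetter

end
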